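import Summits.BirchSwinnertonDyer.BirchSwinnertonDyer.Theses.SylvesterTwoHeegnerIndex
import HarnessLib

/-!
# Route `SylvesterTwoHeegnerIndex` (rung K7t), crux `HeegnerIndexLowerAtTwoHSY` (item 19230):
# what the LOWER half says — content disclosure in the kernel

HONEST FRAMING (cell «bsd-cm», seat `bsd-cm-k7t-c3`, D-0074 group (G); FULL-BSD RANK ≤ 1 programme,
tranche 1a): the class 𝒞_HSY at `p = 2` (B14 / O12: `BSD(E_p, 2)` for the Sylvester curves
`E_p : x³ + y³ = p`, `p ≡ 4, 7 (mod 9)` prime, `3 ∉ 𝔽_p^{×3}`) is OPEN in print and stays open here.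
This file asserts nothing: it PROVES, sorry-free, what the route's crux
`HeegnerIndexLowerAtTwoHSY` (`ord₂ 𝔮(W, K, P, c, k, Wd, u) ≤ ord₂ #Ш(W)` in every Heegner frame of
every minimal model `W ≅ E_p`) amounts to, so that the tribunal and the planner read its content off
the kernel rather than off prose:

* §1 `heegnerIndexLowerAtTwoHSY_of_cmRankOneHeegnerIndexLowerAtTwo` — the crux is the RESTRICTION to
  𝒞_HSY of the cell's typed IMC half `P2.CMRankOneHeegnerIndexLowerAtTwo` (p396963).
* §2 per member and per frame: `lower_frame_of_missingLowerBoundAt` — granted Gross–Zagier and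
  Kolyvagin for THAT frame, GZK, modularity and Burungale–Flach 2024, the cell's typed half
  `Typed.MissingLowerBoundAt W 2` (`ord₂ #Ш_an(W) ≤ ord₂ #Ш(W)`) gives the crux's inequality in the
  frame (the halvability value `k` is pinned by its `iff`); `lower_frame_of_bsdp` — so does
  `BSDp W 2` (the shape of a member-level / t3 instance: a certified `BSD(E_p, 2)` at one `p` gives
  the lower inequality in EVERY Heegner frame of `E_p`); and conversely
  `missingLowerBoundAt_of_lower_frame`.
* §3 class level, modulo the route's OWN support item `PublishedFactsTwo` (19231):
  `heegnerIndexLowerAtTwoHSY_iff_missingLowerBoundAt_onFamily` —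
  `HeegnerIndexLowerAtTwoHSY ⟺ ∀ members W of 𝒞_HSY, MissingLowerBoundAt W 2`: the attacked crux IS
  the IMC ("`#Ш ⊇`") half of `BSD₂` on the family, no more and no less; and
  `heegnerIndexLowerAtTwoHSY_of_cmAtTwo` — the rung leaf `X12.CMAtTwo` gives the crux back
  (honesty clause: the crux is NECESSARY for the leaf, granted 19231).

WHAT THIS IS NOT: not a proof of the crux, of `BSD(E_p, 2)` for any `p`, or of any cell of the
230-class book; no label moves. Why the crux cannot close as typed without 19231: it is fact-free,
and every proof path needs `rank E_p(ℚ) = 1 ∧ #Ш(E_p) < ∞` (GZK / Hu–Shu–Yin Thm 1.3), which the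
kernel does not have unconditionally.
[cite: Miller2011LMS, Def. 1.1] [cite: BurungaleFlach2024, Thm. 1.1 and Cor. 2] [cite: HuShuYin2019, Thm. 1.3 and Thm. 1.4 (p. 3)]
-/

set_option autoImplicit false
set_option linter.dupNamespace false

noncomputable section

open scoped Classical

open WeierstrassCurve NumberField Literature.NumberTheory.EllipticCurves
  Literature.NumberTheory.EllipticCurves.ModularForms
  Literature.NumberTheory.EllipticCurves.Rank1Residual
  Literature.NumberTheory.EllipticCurves.Rank1Residual.Typed
  Literature.NumberTheory.EllipticCurves.HuShuYin2019
  Summit.BirchSwinnertonDyer.Rank1Residual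
  Summit.BirchSwinnertonDyer.Rank1Residual.P2
  Summit.BirchSwinnertonDyer.BirchSwinnertonDyer.Theses.SylvesterTwoHeegnerIndex

namespace Summit.BirchSwinnertonDyer.BirchSwinnertonDyer.Theorems.SylvesterTwoLower

/-! ## §1 The crux is the restriction of the cell's typed IMC half -/

/-- **§1.** The cell's typed IMC half at `2` for EVERY CM curve of analytic rank one
(`P2.CMRankOneHeegnerIndexLowerAtTwo`, p396963) implies the route's crux verbatim: the crux is its
restriction to the Hu–Shu–Yin family 𝒞_HSY. [cite: Miller2011LMS, Def. 1.1] -/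
theorem heegnerIndexLowerAtTwoHSY_of_cmRankOneHeegnerIndexLowerAtTwo
    (h : CMRankOneHeegnerIndexLowerAtTwo) : HeegnerIndexLowerAtTwoHSY := by
  intro p _ _ _ W _ _ _ N _ K _ _ Dt H ι P Wd _ _ Cd k hcm hr hK hHN hP hLt hWd hk12 hkiff
  exact h W N K Dt H ι P Wd Cd k hcm hr hK hHN hP hLt hWd hk12 hkiff

/-! ## §2 Per member, per frame -/

/-- Pinning of the halvability value: two numbers in `{1, 2}` with the same `iff` against one
proposition are equal. Bookkeeping. [folklore] -/
theorem halvability_eq {k k' : ℕ} {A : Prop} (hk : k = 1 ∨ k = 2) (hk' : k' = 1 ∨ k' = 2)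
    (hiff : k = 2 ↔ A) (hiff' : k' = 2 ↔ A) : k = k' := by
  rcases hk with rfl | rfl <;> rcases hk' with rfl | rfl
  · rfl
  · exact absurd (hiff.mpr (hiff'.mp rfl)) (by decide)
  · exact absurd (hiff'.mpr (hiff.mp rfl)) (by decide)
  · rfl

/-- **§2a. The typed half gives the crux's inequality in a frame.** For a globally minimal CM `W` of
analytic rank one and a Heegner frame `(N, K, Dt, H, ι, P, Wd, Cd, k)` as in the crux, granted
Gross–Zagier and Kolyvagin for that frame, GZK, modularity and Burungale–Flach 2024:
`MissingLowerBoundAt W 2 → ord₂ 𝔮 ≤ ord₂ #Ш(W)`. (`P2.missingHalves_two_iff_cmHeegnerIndex` with the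
halvability value pinned.) [cite: BurungaleFlach2024, Thm. 1.1 and Cor. 2] [cite: Miller2011LMS, Def. 1.1] -/
theorem lower_frame_of_missingLowerBoundAt
    (W : WeierstrassCurve ℚ) [W.IsElliptic] [W.IsGloballyMinimal]
    (N : ℕ) [NeZero N] (K : Type) [Field K] [NumberField K]
    (Dt : ModularParametrizationData W N) (H : HeegnerDatum N (NumberField.discr K)) (ι : K →+* ℂ)
    (P : (W.baseChange K).toAffine.Point)
    (Wd : WeierstrassCurve ℚ) [Wd.IsElliptic] [Wd.IsGloballyMinimal] (Cd : VariableChange ℚ) (k : ℕ)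
    (hGZ : gross_zagier N W K) (hKo : kolyvagin N W K)
    (hGZK : rank_eq_analyticRank_of_analyticRank_le_one) (hmod : hasEntireLFunction_rat)
    (hBF : bsdTriple_of_hasCM_of_L_one_ne_zero)
    (hcm : W.HasCM) (hr : W.analyticRank = 1) (hK : IsImaginaryQuadratic K)
    (hHN : SatisfiesHeegnerHypothesis N K)
    (hP : WeierstrassCurve.Affine.Point.map ι.toRatAlgHom P = heegnerPointComplex Dt H)
    (hLt : (W.quadraticTwist (NumberField.discr K : ℚ)).entireLFunction 1 ≠ 0)
    (hWd : Cd • W.quadraticTwist (NumberField.discr K : ℚ) = Wd) (hk12 : k = 1 ∨ k = 2)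
    (hkiff : k = 2 ↔ ∀ y : W.toAffine.Point, ∃ Q : (W.baseChange K).toAffine.Point,
      QuadraticDescent.incl K W y - (2 : ℤ) • Q ∈ AddCommGroup.torsion (W.baseChange K).toAffine.Point)
    (hlo : MissingLowerBoundAt W 2) :
    padicValRat 2 (cmHeegnerIndexQuotient W K P Dt.c k Wd Cd.u) ≤ padicValNat 2 (Nat.card W.sha) := by
  obtain ⟨k', hk12', hkiff', hloiff, -⟩ := missingHalves_two_iff_cmHeegnerIndex W N K Dt H ι P hGZ hKo
    hGZK hmod hBF hcm hK hHN hP hr hLt Wd Cd hWd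
  have hkk : k = k' := halvability_eq hk12 hk12' hkiff hkiff'
  subst hkk
  exact hloiff.mp hlo

/-- **§2a, converse.** In the same frame the crux's inequality gives the typed half
`MissingLowerBoundAt W 2`. [cite: BurungaleFlach2024, Thm. 1.1 and Cor. 2] [cite: Miller2011LMS, Def. 1.1] -/
theorem missingLowerBoundAt_of_lower_frame
    (W : WeierstrassCurve ℚ) [W.IsElliptic] [W.IsGloballyMinimal]
    (N : ℕ) [NeZero N] (K : Type) [Field K] [NumberField K]
    (Dt : ModularParametrizationData W N) (H : HeegnerDatum N (NumberField.discr K)) (ι : K →+* ℂ)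
    (P : (W.baseChange K).toAffine.Point)
    (Wd : WeierstrassCurve ℚ) [Wd.IsElliptic] [Wd.IsGloballyMinimal] (Cd : VariableChange ℚ) (k : ℕ)
    (hGZ : gross_zagier N W K) (hKo : kolyvagin N W K)
    (hGZK : rank_eq_analyticRank_of_analyticRank_le_one) (hmod : hasEntireLFunction_rat)
    (hBF : bsdTriple_of_hasCM_of_L_one_ne_zero)
    (hcm : W.HasCM) (hr : W.analyticRank = 1) (hK : IsImaginaryQuadratic K)
    (hHN : SatisfiesHeegnerHypothesis N K)
    (hP : WeierstrassCurve.Affine.Point.map ι.toRatAlgHom P = heegnerPointComplex Dt H)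
    (hLt : (W.quadraticTwist (NumberField.discr K : ℚ)).entireLFunction 1 ≠ 0)
    (hWd : Cd • W.quadraticTwist (NumberField.discr K : ℚ) = Wd) (hk12 : k = 1 ∨ k = 2)
    (hkiff : k = 2 ↔ ∀ y : W.toAffine.Point, ∃ Q : (W.baseChange K).toAffine.Point,
      QuadraticDescent.incl K W y - (2 : ℤ) • Q ∈ AddCommGroup.torsion (W.baseChange K).toAffine.Point)
    (hle : padicValRat 2 (cmHeegnerIndexQuotient W K P Dt.c k Wd Cd.u) ≤ padicValNat 2 (Nat.card W.sha)) :
    MissingLowerBoundAt W 2 := by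
  obtain ⟨k', hk12', hkiff', hloiff, -⟩ := missingHalves_two_iff_cmHeegnerIndex W N K Dt H ι P hGZ hKo
    hGZK hmod hBF hcm hK hHN hP hr hLt Wd Cd hWd
  have hkk : k = k' := halvability_eq hk12 hk12' hkiff hkiff'
  subst hkk
  exact hloiff.mpr hle

/-- **§2b. `BSD(W, 2)` gives the crux's inequality in EVERY frame of `W`** (the member-level / t3
shape: a certified `BSD(E_p, 2)` at one `p` yields the lower inequality for all Heegner frames of
`E_p`), granted Gross–Zagier and Kolyvagin for the frame, GZK, modularity, Burungale–Flach 2024.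
[cite: Miller2011LMS, Def. 1.1] [cite: BurungaleFlach2024, Thm. 1.1 and Cor. 2] -/
theorem lower_frame_of_bsdp
    (W : WeierstrassCurve ℚ) [W.IsElliptic] [W.IsGloballyMinimal]
    (N : ℕ) [NeZero N] (K : Type) [Field K] [NumberField K]
    (Dt : ModularParametrizationData W N) (H : HeegnerDatum N (NumberField.discr K)) (ι : K →+* ℂ)
    (P : (W.baseChange K).toAffine.Point)
    (Wd : WeierstrassCurve ℚ) [Wd.IsElliptic] [Wd.IsGloballyMinimal] (Cd : VariableChange ℚ) (k : ℕ)
    (hGZ : gross_zagier N W K) (hKo : kolyvagin N W K)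
    (hGZK : rank_eq_analyticRank_of_analyticRank_le_one) (hmod : hasEntireLFunction_rat)
    (hBF : bsdTriple_of_hasCM_of_L_one_ne_zero)
    (hcm : W.HasCM) (hr : W.analyticRank = 1) (hK : IsImaginaryQuadratic K)
    (hHN : SatisfiesHeegnerHypothesis N K)
    (hP : WeierstrassCurve.Affine.Point.map ι.toRatAlgHom P = heegnerPointComplex Dt H)
    (hLt : (W.quadraticTwist (NumberField.discr K : ℚ)).entireLFunction 1 ≠ 0)
    (hWd : Cd • W.quadraticTwist (NumberField.discr K : ℚ) = Wd) (hk12 : k = 1 ∨ k = 2)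
    (hkiff : k = 2 ↔ ∀ y : W.toAffine.Point, ∃ Q : (W.baseChange K).toAffine.Point,
      QuadraticDescent.incl K W y - (2 : ℤ) • Q ∈ AddCommGroup.torsion (W.baseChange K).toAffine.Point)
    (hB : BSDp W 2) :
    padicValRat 2 (cmHeegnerIndexQuotient W K P Dt.c k Wd Cd.u) ≤ padicValNat 2 (Nat.card W.sha) := by
  obtain ⟨k', hk12', hkiff', hiff⟩ := bsdp_two_iff_cmHeegnerIndex W N K Dt H ι P hGZ hKo hGZK hmod hBF
    hcm hK hHN hP hr hLt Wd Cd hWd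
  have hkk : k = k' := halvability_eq hk12 hk12' hkiff hkiff'
  subst hkk
  exact (hiff.mp hB).le

/-! ## §3 Class level, modulo the route's support item `PublishedFactsTwo` -/

/-- **§3a. CONTENT OF THE CRUX.** Granted the route's own support item `PublishedFactsTwo` (19231),
`HeegnerIndexLowerAtTwoHSY ⟺ (∀ W ∈ 𝒞_HSY, MissingLowerBoundAt W 2)`: the attacked crux is EXACTLY
the IMC half `ord₂ #Ш_an(E_p) ≤ ord₂ #Ш(E_p)` of `BSD(E_p, 2)` on the Hu–Shu–Yin family — open in
print (no main conjecture / explicit `2`-adic Gross–Zagier formula at the supersingular prime `2` for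
these CM curves). `→`: `r_an = 1` and CM on the family (HSY Thm 1.3 via `bsdp_three_of_thm14'`,
`Sylvester.hasCM_of_model`), sign `−1` (parity), a Heegner field with rank-zero twin (Waldspurger),
a Heegner point and a minimal twist model, then §2a-converse; `←`: §2a.
[cite: HuShuYin2019, Thm. 1.3 and Thm. 1.4 (p. 3)] [cite: Darmon2004, §3.9] [cite: Miller2011LMS, Def. 1.1] -/
theorem heegnerIndexLowerAtTwoHSY_iff_missingLowerBoundAt_onFamily (hF : PublishedFactsTwo) :
    HeegnerIndexLowerAtTwoHSY ↔
      ∀ (p : ℕ), p.Prime → (p % 9 = 4 ∨ p % 9 = 7) → (¬ ∃ x : ZMod p, x ^ 3 = 3) →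
        ∀ (W : WeierstrassCurve ℚ) [W.IsElliptic] [W.IsGloballyMinimal],
          (∃ C : VariableChange ℚ, C • W = cubeSumCurve (p : ℚ)) → MissingLowerBoundAt W 2 := by
  obtain ⟨hHSY, hBF, hmod, -, -, hGZ, hKo, hGZK, hWa, hpar, hHP⟩ := hF
  constructor
  · intro hlo p hp h9 h3 W _ _ hW
    obtain ⟨hr, -, -⟩ := X12.CubeSumFamilies.bsdp_three_of_thm14' hHSY hBF hmod hp h9 h3 W hW
    have hcm : W.HasCM := X12.Sylvester.hasCM_of_model W hW
    have hw : W.rootNumber = -1 := by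
      rcases W.rootNumber_eq_one_or with hw | hw
      · exact absurd ((hpar W).mpr hw) (by rw [hr]; exact Nat.not_even_one)
      · exact hw
    obtain ⟨K, _, _, hKq, hH, hLt⟩ := hWa.exists W hw
    haveI : NeZero (W.conductorNorm ℤ) := ⟨(W.conductorNorm_pos_holds).ne'⟩
    obtain ⟨P, Dt, Hg, ι, hP⟩ := hHP W K hKq hH
    have hd : (NumberField.discr K : ℚ) ≠ 0 := by exact_mod_cast NumberField.discr_ne_zero K
    haveI := W.isElliptic_quadraticTwist hd
    obtain ⟨Cd, hCd⟩ := hasGlobalMinimalModel_rat_holds (W.quadraticTwist (NumberField.discr K : ℚ))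
    haveI := hCd
    obtain ⟨k, hk12, hkiff, hloiff, -⟩ := missingHalves_two_iff_cmHeegnerIndex W (W.conductorNorm ℤ) K
      Dt Hg ι P (hGZ _ W K) (hKo _ W K) hGZK hmod hBF hcm hKq hH hP hr hLt
      (Cd • W.quadraticTwist (NumberField.discr K : ℚ)) Cd rfl
    exact hloiff.mpr
      (hlo p hp h9 h3 W hW (W.conductorNorm ℤ) K Dt Hg ι P _ Cd k hcm hr hKq hH hP hLt rfl hk12 hkiff)
  · intro h p hp h9 h3 W _ _ hW N _ K _ _ Dt H ι P Wd _ _ Cd k hcm hr hK hHN hP hLt hWd hk12 hkiff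
    exact lower_frame_of_missingLowerBoundAt W N K Dt H ι P Wd Cd k (hGZ N W K) (hKo N W K) hGZK hmod
      hBF hcm hr hK hHN hP hLt hWd hk12 hkiff (h p hp h9 h3 W hW)

/-- **§3b. HONESTY CLAUSE: the rung leaf gives the crux back.** Granted `PublishedFactsTwo`, the leaf
`X12.CMAtTwo` (`BSD(E_p, 2)` on 𝒞_HSY) implies `HeegnerIndexLowerAtTwoHSY` — so, with the route's
`Assembly` (19232, closed), the two cruxes are jointly EQUIVALENT to the leaf modulo 19231, and the
lower crux alone is a necessary condition. [cite: Miller2011LMS, Def. 1.1] [cite: BurungaleFlach2024, Thm. 1.1 and Cor. 2] -/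
theorem heegnerIndexLowerAtTwoHSY_of_cmAtTwo (hF : PublishedFactsTwo) (hleaf : X12.CMAtTwo) :
    HeegnerIndexLowerAtTwoHSY := by
  obtain ⟨-, hBF, hmod, -, -, hGZ, hKo, hGZK, -, -, -⟩ := hF
  intro p hp h9 h3 W _ _ hW N _ K _ _ Dt H ι P Wd _ _ Cd k hcm hr hK hHN hP hLt hWd hk12 hkiff
  exact lower_frame_of_bsdp W N K Dt H ι P Wd Cd k (hGZ N W K) (hKo N W K) hGZK hmod hBF hcm hr hK hHN
    hP hLt hWd hk12 hkiff (hleaf p hp h9 h3 W hW)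

end Summit.BirchSwinnertonDyer.BirchSwinnertonDyer.Theorems.SylvesterTwoLower

end
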